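import Summits.QuantumFields.YangMills.Theorems.LuscherReductionOneSiteLevelsGnHaar
import HarnessLib

/-!
# The a-priori measure of the `L³` torus in the per-link GNOMONIC chart: `σ^{⊗E} = Σ_{z : E → Bool} (∏_e w(w_e) dw) ∘ (latPatternChart z)⁻¹`
# (entrance to the Laplace step of the near-vacuum analysis for both COARSE lanes; lane B of S-BASE, crux `TwistedTraceScaling` stmt-QuantumFields-20203)

ONE's lane computed every one-site integral in the gnomonic coordinates `v = u/u₀` of each link (tree
`haarProbability_su2_eq_sum_hemiChart`: Haar `= Σ_b ν∘(hemiChart b)⁻¹`, `ν = (2π²)⁻¹(1+|v|²)⁻² dv`; `configMeasure_su2_one_eq_sum_patternChart`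
for the three links of one site).  The same holds link by link on the torus `(ℤ/L)³` with its `|E| = 3L³` links; this file multiplies it out:

* `latPatternChart L z w` — link `e` is `hemiChart (z e) (w e)` (`z : Edge → Bool` the hemisphere pattern, `w : Edge → ℝ³` the coordinates);
* ★ `configMeasure_su2_eq_sum_latPatternChart` — `configMeasure SU2 L = Σ_z ((⊗_e dv)·∏_e w(w_e)) ∘ (latPatternChart L z)⁻¹`;
* `lintegral_configMeasure_eq_sum_latPatternChart`, `integral_configMeasure_eq_sum_latPatternChart` — the change-of-variables formulas for
  non-negative measurable / bounded measurable integrands: `∫ g dσ^{⊗E} = Σ_z ∫ (∏_e w(w_e)) g(latPatternChart z w) dw`.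

So every kernel integral `∫ K_β(U,V) H(V) dV` of the COARSE programme is a finite sum of Lebesgue integrals over `(Edge 3 L → ℝ³)` with an
explicit bounded density — where the Gaussian sandwiches of `…KineticChart` / `…MagneticLattice` / `…StiffHessian` apply.
HONEST FRAMING: measure bookkeeping (Fubini over links); femto rung R2b1 (stub of a child of a CONDITIONAL route); not a gap, not Clay.
-/

set_option autoImplicit false

noncomputable section

open MeasureTheory Filter Topology Real
open scoped ENNReal BigOperators
open Literature.MathematicalPhysics.QuantumFieldTheory
open Literature.MathematicalPhysics.QuantumLattice
open Literature.MathematicalPhysics.QuantumFieldTheory.Balaban1983to89.T4CubeChartGnomonic (gnoPoint gnoWeight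
  gnoWeight_pos gnoWeight_le measurable_gnoWeight continuous_gnoPoint)

namespace Summit.QuantumFields.YangMills.Theorems.FemtoTransferGap.TwoLattice.GnChart

open Summit.QuantumFields.YangMills.Theorems.FemtoTransferGap

variable (L : ℕ) [NeZero L]

/-! ## §1 The pattern chart of the torus -/

/-- **The per-link gnomonic pattern chart of the torus**: link `e` carries `hemiChart (z e) (w e) = (±1)·P(1, w_e)`. [folklore] -/
def latPatternChart (z : Edge 3 L → Bool) (w : Edge 3 L → Fin 3 → ℝ) : GaugeConfig 3 L SU2 := fun e => hemiChart (z e) (w e)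

omit [NeZero L] in
/-- The pattern chart is measurable. [folklore] -/
theorem measurable_latPatternChart (z : Edge 3 L → Bool) : Measurable (latPatternChart L z) :=
  measurable_pi_lambda _ fun e => (measurable_hemiChart (z e)).comp (measurable_pi_apply e)

/-- The product gnomonic density `∏_e w(w_e)` as an `ℝ≥0∞`-valued function. [folklore] -/
def latGnDensity (w : Edge 3 L → Fin 3 → ℝ) : ℝ≥0∞ := ∏ e, ENNReal.ofReal (gnoWeight (w e))

/-- … and as a real function. [folklore] -/
def latGnDensityReal (w : Edge 3 L → Fin 3 → ℝ) : ℝ := ∏ e, gnoWeight (w e)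

/-- `latGnDensity = ofReal ∘ latGnDensityReal`. [folklore] -/
theorem latGnDensity_eq (w : Edge 3 L → Fin 3 → ℝ) : latGnDensity L w = ENNReal.ofReal (latGnDensityReal L w) := by
  unfold latGnDensity latGnDensityReal
  rw [ENNReal.ofReal_prod_of_nonneg fun e _ => (gnoWeight_pos (w e)).le]

/-- `0 < ∏_e w(w_e) ≤ (2π²)^{−|E|}`. [folklore] -/
theorem latGnDensityReal_pos_le (w : Edge 3 L → Fin 3 → ℝ) :
    0 < latGnDensityReal L w ∧ latGnDensityReal L w ≤ ((2 * π ^ 2)⁻¹) ^ Fintype.card (Edge 3 L) := by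
  unfold latGnDensityReal
  refine ⟨Finset.prod_pos fun e _ => gnoWeight_pos _, ?_⟩
  rw [← Finset.card_univ, ← Finset.prod_const]
  exact Finset.prod_le_prod (fun e _ => (gnoWeight_pos _).le) fun e _ => gnoWeight_le _

/-- The density is measurable. [folklore] -/
theorem measurable_latGnDensity : Measurable (latGnDensity L) := by
  unfold latGnDensity
  exact Finset.measurable_prod _ fun e _ => ENNReal.measurable_ofReal.comp (measurable_gnoWeight.comp (measurable_pi_apply e))

/-- The real density is measurable. [folklore] -/
theorem measurable_latGnDensityReal : Measurable (latGnDensityReal L) := by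
  unfold latGnDensityReal
  exact Finset.measurable_prod _ fun e _ => measurable_gnoWeight.comp (measurable_pi_apply e)

/-! ## §2 The configuration measure as a sum over hemisphere patterns -/

/-- ★ **The a-priori measure of the torus in the gnomonic chart**:
`configMeasure SU2 L = Σ_{z : Edge → Bool} ((⊗_e dv) · ∏_e w(w_e)) ∘ (latPatternChart L z)⁻¹`. [folklore] -/
theorem configMeasure_su2_eq_sum_latPatternChart :
    configMeasure SU2 L = Measure.sum fun z : Edge 3 L → Bool =>
      (((volume : Measure (Edge 3 L → Fin 3 → ℝ)).withDensity (latGnDensity L)).map (latPatternChart L z)) := by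
  haveI := isFiniteMeasure_gnoDensityMeasure
  unfold configMeasure
  rw [haarProbability_su2_eq_sum_hemiChart, pi_add_eq_sum_pi (fun b => gnoDensityMeasure.map (hemiChart b))]
  congr 1
  funext z
  have hpi : (Measure.pi fun _ : Edge 3 L => gnoDensityMeasure).map (fun w e => hemiChart (z e) (w e)) =
      Measure.pi fun e => gnoDensityMeasure.map (hemiChart (z e)) :=
    Measure.pi_map_pi fun e => (measurable_hemiChart (z e)).aemeasurable
  rw [← hpi]
  have hdens : (Measure.pi fun _ : Edge 3 L => gnoDensityMeasure) =
      (volume : Measure (Edge 3 L → Fin 3 → ℝ)).withDensity (latGnDensity L) := by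
    rw [gnoDensityMeasure, volume_pi]
    exact GaussianToolkit.pi_withDensity (fun _ : Edge 3 L => (volume : Measure (Fin 3 → ℝ)))
      (fun _ => fun v => ENNReal.ofReal (gnoWeight v)) fun _ => ENNReal.measurable_ofReal.comp measurable_gnoWeight
  rw [hdens]
  rfl

/-! ## §3 Change-of-variables formulas -/

/-- **Lower-integral change of variables**: for measurable `g ≥ 0`,
`∫ g dσ^{⊗E} = Σ_z ∫ g(latPatternChart z w) · ∏_e w(w_e) dw`. [folklore] -/
theorem lintegral_configMeasure_eq_sum_latPatternChart {g : GaugeConfig 3 L SU2 → ℝ≥0∞} (hg : Measurable g) :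
    ∫⁻ U, g U ∂(configMeasure SU2 L) =
      ∑ z : Edge 3 L → Bool, ∫⁻ w, g (latPatternChart L z w) * latGnDensity L w ∂volume := by
  rw [configMeasure_su2_eq_sum_latPatternChart L, lintegral_sum_measure, tsum_fintype]
  refine Finset.sum_congr rfl fun z _ => ?_
  rw [lintegral_map hg (measurable_latPatternChart L z), lintegral_withDensity_eq_lintegral_mul _ (measurable_latGnDensity L)
    (show Measurable (fun w => g (latPatternChart L z w)) from hg.comp (measurable_latPatternChart L z))]
  refine lintegral_congr fun w => ?_
  simp only [Pi.mul_apply, mul_comm]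

/-- A bounded measurable real function is integrable for the a-priori (probability) measure of the torus. [folklore] -/
theorem integrable_configMeasure_of_bounded {g : GaugeConfig 3 L SU2 → ℝ} (hg : Measurable g) (hb : ∃ C : ℝ, ∀ U, |g U| ≤ C) :
    Integrable g (configMeasure SU2 L) := by
  obtain ⟨C, hC⟩ := hb
  exact Integrable.mono' (integrable_const C) hg.aestronglyMeasurable (ae_of_all _ fun U => by
    rw [Real.norm_eq_abs]; exact hC U)

/-- ★ **Change of variables for bounded measurable real integrands**:
`∫ g dσ^{⊗E} = Σ_z ∫ (∏_e w(w_e)) · g(latPatternChart z w) dw`. [folklore] -/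
theorem integral_configMeasure_eq_sum_latPatternChart {g : GaugeConfig 3 L SU2 → ℝ} (hg : Measurable g)
    (hb : ∃ C : ℝ, ∀ U, |g U| ≤ C) :
    ∫ U, g U ∂(configMeasure SU2 L) =
      ∑ z : Edge 3 L → Bool, ∫ w, latGnDensityReal L w * g (latPatternChart L z w) ∂volume := by
  have hint : Integrable g (configMeasure SU2 L) := integrable_configMeasure_of_bounded L hg hb
  rw [configMeasure_su2_eq_sum_latPatternChart L] at hint ⊢
  rw [integral_sum_measure hint, tsum_fintype]
  refine Finset.sum_congr rfl fun z _ => ?_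
  rw [integral_map (measurable_latPatternChart L z).aemeasurable hg.aestronglyMeasurable,
    integral_withDensity_eq_integral_toReal_smul (measurable_latGnDensity L)
      (ae_of_all _ fun w => by rw [latGnDensity_eq]; exact ENNReal.ofReal_lt_top)]
  refine integral_congr_ae (ae_of_all _ fun w => ?_)
  show (latGnDensity L w).toReal • g (latPatternChart L z w) = latGnDensityReal L w * g (latPatternChart L z w)
  rw [latGnDensity_eq, ENNReal.toReal_ofReal (latGnDensityReal_pos_le L w).1.le, smul_eq_mul]

/-! ## §4 The chart on the vacuum pattern: links near the identity -/

omit [NeZero L] in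
/-- On the vacuum pattern (`z ≡ false`) every link is `P(1, w_e)` (upper hemisphere, `u₀ > 0`). [folklore] -/
theorem latPatternChart_false (w : Edge 3 L → Fin 3 → ℝ) (e : Edge 3 L) :
    latPatternChart L (fun _ => false) w e = gnoPoint (w e) := by
  simp [latPatternChart, hemiChart, hemi]

end Summit.QuantumFields.YangMills.Theorems.FemtoTransferGap.TwoLattice.GnChart

end
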